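import Mathlib
import HarnessLib
import Summits.ResolutionOfSingularities.ResolutionOfSingularities.Theorems.WildQuotientsWildQuotientResolutionS1aPointCentreAway

/-!
# S1a — K-LOC (α1): REGRADING TO THE UNIFORM TRIVIAL GRADING, and the point-type centre on `D(e⁻¹hh)` in uniform form

[OURS · L1 W4.5c · lead-1 g16; plan-1 RULINGS R-F15o/R-F15p — K-LOC brick (m5-pre): ✓`exists_moveAtlas_of_nodes` wants ONE grading index type for the whole family of
producer nodes, while ✓`exists_pointCentre_away` returns each node with its own (opaque) `NodeData` grading, all of whose pieces are full. Two gradings with full degree-0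
pieces have canonically isomorphic degree-0 rings, and traces / Veronese degrees / tameness transport along it] — NOT statements of the manuscript; counted 0; AI-level work,
weaker than expert review. Crux stmt-ResolutionOfSingularities-17941 `CyclicQuotientFourfolds`, line `s1a-logminvertex` v13 (`stub_reachLowerInFX`).

* `NodeTransport.exists_zeroRegrade` (`ζ : 𝒜 0 ≃+* ℬ 0` over `B` for full degree-0 pieces), `comap_traceFiltration_regrade`, `veroneseNormalised_regrade`, `isTameNode_regrade`;
* ★★ `GameFrame.GModel.exists_pointCentre_away₀` — ✓`exists_pointCentre_away` restated with the UNIFORM trivial grading `𝒜u : (Π j : Fin 0, ZMod _) → AddSubgroup L` on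
  `L = k[x][1/hh]`, the automorphism `sigmaAway σ` itself, the node equivalence `eW : Γ(M, D(e⁻¹hh)) ≃ 𝒜u 0` with its PIN on restricted sections, tameness, intertwining, and the
  admissible centre with filtration clause / Veronese degree in terms of `𝒜u` — the per-point input of the R4e assembly.
-/

set_option linter.dupNamespace false

noncomputable section

open CategoryTheory Limits AlgebraicGeometry TopologicalSpace Topology Opposite MvPolynomial
open Literature.AlgebraicGeometry.Resolution Literature.AlgebraicGeometry.RelativeSpec
open Summit.ResolutionOfSingularities.ResolutionOfSingularities.Theorems.WildQuotientResolution.S1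
open Summit.ResolutionOfSingularities.ResolutionOfSingularities.Theorems.WildQuotientResolution.S1.NodeAtlas
open Summit.ResolutionOfSingularities.ResolutionOfSingularities.Theorems.WildQuotientResolution.S1.CoarseChart
open Summit.ResolutionOfSingularities.ResolutionOfSingularities.Theorems.WildQuotientResolution.S1.ProducerStep
open Summit.ResolutionOfSingularities.ResolutionOfSingularities.Theorems.WildQuotientResolution.S1.NpFrame
open Summit.ResolutionOfSingularities.ResolutionOfSingularities.Theorems.WildQuotientResolution.S1.GoodCharts
open Summit.ResolutionOfSingularities.ResolutionOfSingularities.Theorems.WildQuotientResolution.S1.NodeAway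
open Summit.ResolutionOfSingularities.ResolutionOfSingularities.Theorems.WildQuotientResolution.S1.NodeChartAway
open Summit.ResolutionOfSingularities.ResolutionOfSingularities.Theorems.WildQuotientResolution.S1.NodeTransport
open Summit.ResolutionOfSingularities.ResolutionOfSingularities.Theorems.WildQuotientResolution.S1.CentreAway
open Summit.ResolutionOfSingularities.ResolutionOfSingularities.Theorems.WildQuotientResolution.S1.BlowupCharts

/-! ## Regrading along full degree-0 pieces -/

namespace Summit.ResolutionOfSingularities.ResolutionOfSingularities.Theorems.WildQuotientResolution.S1.NodeTransport

variable {B : Type} [CommRing B] {ι₁ ι₂ : Type} [AddCommGroup ι₁] [DecidableEq ι₁] [AddCommGroup ι₂] [DecidableEq ι₂]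
  (𝒜 : ι₁ → AddSubgroup B) (ℬ : ι₂ → AddSubgroup B) [GradedRing 𝒜] [GradedRing ℬ]

/-- Two gradings of `B` whose degree-0 pieces are all of `B` have isomorphic degree-0 rings, compatibly with the coercions to `B`. [folklore] -/
theorem exists_zeroRegrade (h𝒜 : ∀ x : B, x ∈ 𝒜 0) (hℬ : ∀ x : B, x ∈ ℬ 0) :
    ∃ ζ : ↥(𝒜 0) ≃+* ↥(ℬ 0), ∀ x : ↥(𝒜 0), ((ζ x : ↥(ℬ 0)) : B) = (x : B) :=
  ⟨{ toFun := fun x => ⟨x.1, hℬ x.1⟩, invFun := fun x => ⟨x.1, h𝒜 x.1⟩, left_inv := fun _ => Subtype.ext rfl, right_inv := fun _ => Subtype.ext rfl,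
     map_mul' := fun _ _ => Subtype.ext rfl, map_add' := fun _ _ => Subtype.ext rfl }, fun _ => rfl⟩

/-- The degree-0 traces of a weighted filtration correspond under a coercion-compatible `ζ : 𝒜 0 ≃+* ℬ 0`. -/
theorem comap_traceFiltration_regrade {c : ℕ} (f : Fin c → B) (w : Fin c → ℕ) (ζ : ↥(𝒜 0) ≃+* ↥(ℬ 0)) (hζ : ∀ x : ↥(𝒜 0), ((ζ x : ↥(ℬ 0)) : B) = (x : B)) (n : ℕ) :
    ((traceFiltration ℬ f w).ideal n).comap (ζ : ↥(𝒜 0) →+* ↥(ℬ 0)) = (traceFiltration 𝒜 f w).ideal n := by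
  ext x
  rw [Ideal.mem_comap, RingHom.coe_coe, mem_traceFiltration_iff, mem_traceFiltration_iff, hζ]

/-- A Veronese degree transports along a coercion-compatible `ζ : 𝒜 0 ≃+* ℬ 0`. -/
theorem veroneseNormalised_regrade {c : ℕ} (f : Fin c → B) (w : Fin c → ℕ) (ζ : ↥(𝒜 0) ≃+* ↥(ℬ 0)) (hζ : ∀ x : ↥(𝒜 0), ((ζ x : ↥(ℬ 0)) : B) = (x : B))
    {d : ℕ} (h : VeroneseNormalised 𝒜 f w d) : VeroneseNormalised ℬ f w d := by
  refine ⟨h.1, fun l => ?_⟩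
  apply Ideal.comap_injective_of_surjective (ζ : ↥(𝒜 0) →+* ↥(ℬ 0)) ζ.surjective
  rw [comap_traceFiltration_regrade 𝒜 ℬ f w ζ hζ, comap_equiv_pow, comap_traceFiltration_regrade 𝒜 ℬ f w ζ hζ, h.2 l]

/-- Tameness transports to any grading all of whose pieces are full, over a finite index group. -/
theorem isTameNode_regrade [Finite ι₂] (p : ℕ) (σ : B ≃+* B) (hℬ : ∀ (d : ι₂) (x : B), x ∈ ℬ d) (h : IsTameNode p B 𝒜 σ) : IsTameNode p B ℬ σ := by
  obtain ⟨hN, hR, -, -, -, hit⟩ := h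
  refine ⟨hN, hR, ⟨∅, fun _ h => absurd h (Finset.notMem_empty _), ?_⟩, ⟨∅, ?_⟩, fun d b _ => hℬ d _, hit⟩
  · rw [Finset.coe_empty, AddSubgroup.closure_empty]; infer_instance
  · exact eq_top_iff.mpr fun x _ => Subring.subset_closure (Or.inl (hℬ 0 x))

end Summit.ResolutionOfSingularities.ResolutionOfSingularities.Theorems.WildQuotientResolution.S1.NodeTransport

/-! ## The point-type centre on `D(e⁻¹hh)` in uniform form -/

namespace Summit.ResolutionOfSingularities.ResolutionOfSingularities.Theorems.WildQuotientResolution.S1.GameFrame.GModel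

variable {p : ℕ} {X' X₁ : Scheme.{0}} {q : X' ⟶ X₁} {G : Type} [Group G] {ρ : G →* Aut X'} {g₀ : G}

set_option maxHeartbeats 4000000 in
/-- ★★ **THE ADMISSIBLE POINT-TYPE CENTRE ON `D(e⁻¹hh)`, UNIFORM TRIVIAL GRADING, `σ = sigmaAway σ`** (✓`exists_pointCentre_away` regraded). See the module docstring.
[OURS · L1 W4.5c · K-LOC (α1); NOT a statement of the manuscript] -/
theorem exists_pointCentre_away₀ [Finite G] (hG : ∀ g : G, g ∈ Subgroup.zpowers g₀) (M : GModel p q G ρ g₀) [M.V.IsSeparated]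
    (O : M.act.StableAffineOpens) (hO : IsAffineOpen O.1)
    {k : Type} [Field k] {ι : Type} [Fintype ι] [DecidableEq ι] (e : Γ(M.V, O.1) ≃+* MvPolynomial ι k) (σ : MvPolynomial ι k ≃+* MvPolynomial ι k)
    (hact : ∀ t : Γ(M.V, O.1), actOEquiv M.act O g₀ t = e.symm (σ (e t))) (hσp : ∀ a : MvPolynomial ι k, (⇑σ)^[p] a = a)
    (hh : MvPolynomial ι k) (hσh : σ hh = hh)
    {c : ℕ} (hc : 0 < c) (v : Fin c → ι) (hv : Function.Injective v) (w : Fin c → ℕ) (hw : ∀ i, 0 < w i)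
    (hσJ : ∀ n : ℕ, ((weightedFiltration ((X : ι → MvPolynomial ι k) ∘ v) w).ideal n).map (σ : MvPolynomial ι k →+* MvPolynomial ι k) ≤
      (weightedFiltration ((X : ι → MvPolynomial ι k) ∘ v) w).ideal n)
    (g : ι → k) (hg : ∀ i, g (v i) = 0) (hu : MvPolynomial.eval g hh ≠ 0)
    (hZcl : IsClosed (M.V.zeroLocus (U := O.1) (Set.range (e.symm ∘ (X : ι → MvPolynomial ι k) ∘ v)) ∩ (O.1 : Set M.V)))
    (hZW : M.V.zeroLocus (U := O.1) (Set.range (e.symm ∘ (X : ι → MvPolynomial ι k) ∘ v)) ∩ (O.1 : Set M.V) ⊆ (M.V.basicOpen (e.symm hh) : Set M.V)) :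
    ∃ (𝒜u : (Π j : Fin 0, ZMod ((![] : Fin 0 → ℕ) j)) → AddSubgroup (Localization.Away hh)) (_ : GradedRing 𝒜u) (eW : Γ(M.V, (basicOpenStable M.act O hO (actO_symm_eq_of_fixed hG M O e σ hact hh hσh)).1) ≃+* ↥(𝒜u 0)),
      (∀ (i : (Π j : Fin 0, ZMod ((![] : Fin 0 → ℕ) j))) (x : (Localization.Away hh)), x ∈ 𝒜u i) ∧
      IsTameNode p (Localization.Away hh) 𝒜u (sigmaAway σ hσh) ∧
      (∀ t' : Γ(M.V, (basicOpenStable M.act O hO (actO_symm_eq_of_fixed hG M O e σ hact hh hσh)).1), ((eW ((M.act.aut g₀⁻¹).hom.appLE (basicOpenStable M.act O hO (actO_symm_eq_of_fixed hG M O e σ hact hh hσh)).1 (basicOpenStable M.act O hO (actO_symm_eq_of_fixed hG M O e σ hact hh hσh)).1 ((basicOpenStable M.act O hO (actO_symm_eq_of_fixed hG M O e σ hact hh hσh)).2.1 g₀⁻¹).ge t') : ↥(𝒜u 0)) : (Localization.Away hh)) = sigmaAway σ hσh ((eW t' : ↥(𝒜u 0)) : (Localization.Away hh))) ∧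
      (∀ t : Γ(M.V, O.1), ((eW (algebraMap Γ(M.V, O.1) Γ(M.V, M.V.basicOpen (e.symm hh)) t) : ↥(𝒜u 0)) : (Localization.Away hh)) = algebraMap (MvPolynomial ι k) (Localization.Away hh) (e t)) ∧
      ∃ (𝒦 : ReesFiltration M.V) (d : ℕ), 0 < d ∧ IsAdmissibleCentre p M.act g₀ 𝒦 d ∧ IsCentreChart p M.act g₀ 𝒦 d (basicOpenStable M.act O hO (actO_symm_eq_of_fixed hG M O e σ hact hh hσh)) ∧
        (∀ (g : G) (n : ℕ), (𝒦.ideal n).comap (M.act.aut g).hom = 𝒦.ideal n) ∧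
        (∀ n, (𝒦.filtration ⟨(basicOpenStable M.act O hO (actO_symm_eq_of_fixed hG M O e σ hact hh hσh)).1, hO.basicOpen (e.symm hh)⟩).ideal n = ((traceFiltration 𝒜u (fun i => algebraMap (MvPolynomial ι k) (Localization.Away hh) (X (v i))) w).ideal n).comap (eW : Γ(M.V, (basicOpenStable M.act O hO (actO_symm_eq_of_fixed hG M O e σ hact hh hσh)).1) →+* ↥(𝒜u 0))) ∧
        VeroneseNormalised 𝒜u (fun i => algebraMap (MvPolynomial ι k) (Localization.Away hh) (X (v i))) w d ∧
        (((𝒦.ideal d).support : Set M.V)) ⊆ ((basicOpenStable M.act O hO (actO_symm_eq_of_fixed hG M O e σ hact hh hσh)).1 : Set M.V) := by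
  classical
  obtain ⟨DW, Φ, hpin, hconj, htop, 𝒦, d, hd, hadm, hchart, hG𝒦, hfil, hver, hsupp⟩ :=
    exists_pointCentre_away hG M O hO e σ hact hσp hh hσh hc v hv w hw hσJ g hg hu hZcl hZW
  letI := DW.instCommRing
  letI := DW.instGradedRing
  letI := mapGradedRing DW.𝒜 Φ
  obtain ⟨𝒜u, gr, hfull, -⟩ := exists_trivialGradedRing (Π j : Fin 0, ZMod ((![] : Fin 0 → ℕ) j)) (Localization.Away hh)
  letI := gr
  have h1 : ∀ x : (Localization.Away hh), x ∈ mapGrading DW.𝒜 Φ 0 := htop 0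
  have h2 : ∀ (i : (Π j : Fin 0, ZMod ((![] : Fin 0 → ℕ) j))) (x : (Localization.Away hh)), x ∈ 𝒜u i := fun i x => by rw [hfull i]; trivial
  obtain ⟨ζ, hζ⟩ := exists_zeroRegrade (mapGrading DW.𝒜 Φ) 𝒜u h1 (h2 0)
  have hconj' : (conj Φ DW.σ : (Localization.Away hh) ≃+* (Localization.Away hh)) = sigmaAway σ hσh := RingEquiv.ext hconj
  refine ⟨𝒜u, gr, (DW.e.trans (zeroRingEquiv DW.𝒜 Φ)).trans ζ, h2, ?_, ?_, ?_, 𝒦, d, hd, hadm, hchart, hG𝒦, ?_, ?_, hsupp⟩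
  · have ht := isTameNode_map DW.𝒜 Φ p DW.σ DW.tame
    rw [hconj'] at ht
    exact isTameNode_regrade (mapGrading DW.𝒜 Φ) 𝒜u p _ h2 ht
  · intro t'
    rw [RingEquiv.trans_apply, RingEquiv.trans_apply, hζ, coe_zeroRingEquiv, RingEquiv.trans_apply, RingEquiv.trans_apply, hζ, coe_zeroRingEquiv,
      DW.intertwine t', ← hconj, Φ.symm_apply_apply]
  · intro t
    rw [RingEquiv.trans_apply, RingEquiv.trans_apply, hζ, coe_zeroRingEquiv]
    exact hpin t
  · intro n
    have h3 := congrArg (Ideal.comap ((DW.e.trans (zeroRingEquiv DW.𝒜 Φ) : Γ(M.V, (basicOpenStable M.act O hO (actO_symm_eq_of_fixed hG M O e σ hact hh hσh)).1) ≃+* ↥(mapGrading DW.𝒜 Φ 0)) : Γ(M.V, (basicOpenStable M.act O hO (actO_symm_eq_of_fixed hG M O e σ hact hh hσh)).1) →+* ↥(mapGrading DW.𝒜 Φ 0)))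
      (comap_traceFiltration_regrade (mapGrading DW.𝒜 Φ) 𝒜u (fun i => algebraMap (MvPolynomial ι k) (Localization.Away hh) (X (v i))) w ζ hζ n)
    exact (hfil n).trans h3.symm
  · exact veroneseNormalised_regrade (mapGrading DW.𝒜 Φ) 𝒜u (fun i => algebraMap (MvPolynomial ι k) (Localization.Away hh) (X (v i))) w ζ hζ hver

end Summit.ResolutionOfSingularities.ResolutionOfSingularities.Theorems.WildQuotientResolution.S1.GameFrame.GModel

end
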